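import Literature.MathematicalPhysics.QuantumFieldTheory.Balaban1983to89.B9Thm31GpAgmonDivDecayZd
import Literature.MathematicalPhysics.QuantumFieldTheory.Balaban1983to89.B9Thm31GpAgmonDecayNearFlatClassZd

/-!
# `Balaban1983to89.B9Thm31GpAgmonGradDivDecayClassZd` — [Balaban1985BackgroundPropagators] Thm 3.1 (3.42) p. 397, THE GRADIENT AND DIVERGENCE ENTRIES `n = 1, 2` ON THE
# SMALL-PLAQUETTE CLASS: ★★★ at EVERY cube member of [Balaban1985RegularSpaces] (1.131) and EVERY unitary `U₀` with `pdev U₀ < α₀L^{−2k}`, `‖U₀(b) − 1‖ ≤ θ′η`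
# (class smallness `4(2C_uC_l)²(dθ′² + a_hi d²L²(256(d+1)(d+4)α₀ + θ′)²) ≤ m₈`): `|(D_μG′(U₀)δ_y w)(x)|_τ ≤ (24∕√m₈)(ηLᵐ)e^{−κL^{−m}|x−y|_∞}|w|_τ` and
# `|(G′(U₀)𝟙_{□₀}D*δ_b X)(x)|_τ ≤ (24∕√m₈)(ηLᵐ)e^{−κL^{−m}|z−x|_∞}|X|_τ` — MEMBER-UNIFORM constants in `d, L, a_lo, a_hi, C_u, C_l, α₀, θ′` only; NO transporter hypothesis

statement-level skeleton of published theorems with citation tags; proofs where landed; nothing here is a claim about the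
Yang–Mills mass gap

`[Balaban1985BackgroundPropagators]` ("B9", CMP **99** (1985) 389–434) Thm 3.1 p. 397 (*«uniformly in U, Ω_j»*), (3.42) p. 397 entries `n = 1, 2` (`B9.pref4 = [(Lʲη)², Lʲη, Lʲη, 1]`);
Thm 3.11 p. 416; `[Balaban1985Averaging]` Prop. 2 (52)–(54) p. 26, (122)–(126) p. 36 (the averaged backgrounds of the class stay unitary and close to `1`); `[Agmon1982]` Thm 1.5 p. 19.
THIS FILE closes the (3.42) triple `n = 0, 1, 2` on the CLASS: §1 packages the near-flat level data of a cube member ONCE (`∃ M`: the `1∕4`-coercivity of `Δ′_a(U₀)` by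
dag-n06-w4 g5's tower-pair comparison `formE_deltaPrimeADom_one_le_near_flat'` + FILE 7's transfer, the two scaling slots, the mass floor), §2 reads the tower letters off
the class (dag-n06-w4 g5's `B9Thm31NearFlatTransportersZd` + `fnorm_conjR_sub_le_of_cmp`, as in FILE 12), §§3–4 feed FILE 13's coarse gradient bound and FILE 14's duality.

CITATION HEADER (lean-in-tree rule).  Cell `pub-ymgap` (YM Track A, HUMAN RULING D-0062 ∕ D-0149 width push), DAG node N06 = [B9], width seat
`pub-ymgap-dag-n06-w2` (g5), CLAIM-15.  Inputs BY NAME: FILE 13 `levelData_one_cubeMember ∕ fnorm_covDerivFwd_GpZd_single_le_exp_coarse`, FILE 14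
`fnorm_GpZd_restrict_covDivB_le_of_grad`, FILE 7 `levelCoercive_of_comparison`, dag-n06-w4 g5's `formE_deltaPrimeADom_one_le_near_flat' ∕ fnorm_conjR_sub_le_of_cmp ∕
bgT_mem_unitaryUnits_of_pdev ∕ norm_bgT_pair_sub_one_le ∕ sum_eps_sq_weight_le ∕ fullBlockGeometry_cubeMember`.  Nothing restated.

WHAT IS PROVED (kernel, 0 sorry, 0 def; no `instance`, no `notation`).
* §1 ★★ `levelData_cubeMember_tower` — the near-flat level-data package at the tower-pair `τ`-letters (`|R(U₀(x,μ))b − b|_τ ≤ θη|b|_τ`,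
  `|R(Ū₀ⁱ(blockMap L w, w))b − b|_τ ≤ ε_i|b|_τ`, `a_j(Lᵈ)^{−j}(Σ_{i<j}ε_i)² ≤ κ_T`, `4(dθ² + κ_T) ≤ m₈`, `ηLᵐ ≤ 1`): coercivity constant `1∕4`.
* §2 ★★ `levelData_cubeMember_of_class` — the same package ON THE CLASS (letters `hU ∕ hR(θ′η) ∕ α₀ (hα, hα3, hα2, h52)`, `L^{−k} ≤ η`, fibre comparison `C_u, C_l`).
* §3 ★★★ `fnorm_covDerivFwd_GpZd_single_le_exp_cubeMember_of_class` — entry `n = 1` on the class: amplitude `(24∕√m₈)·ηLᵐ`, rate `κL^{−m}` for `κ(48d + 120a_hi) ≤ m₈`.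
* §4 ★★★ `fnorm_GpZd_restrict_covDivB_le_exp_cubeMember_of_class` (finitely supported bond field, heads in `□₀`) ∕ ★★ `…_bond_…` (ONE bond) — entry `n = 2` on the class.

HONEST SCOPE.  (i) The class is displayed by `pdev`, `C0 d α₀ ≤ 1∕3`, `2α₀ ≤ c2′ d L` and the BOND smallness `‖U₀(b) − 1‖ ≤ θ′η` (print's gauge-fixed `U = e^{iηA}`, `A` small —
the axial gauge producing it from (3.35) is NOT here); (ii) single coarsest-scale rate and amplitude, `L²`-derived pointwise bounds; NOT print's multi-scale `d(y,y′)`, NOT the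
sup∕Hölder entries (3.43)–(3.45), NOT (3.46)∕(3.47) on the class, NOT Thm 3.2∕3.3; (iii) bond heads must lie in `□₀`.  Count-neutral; N05 ∕ N06 NOT discharged; K1⁹
`stmt-QuantumFields-27364` NOT closed; one finite `𝕋⁴` programme at fixed `ε`, Bałaban as printed; R4 closes only the conditional finite-`𝕋⁴` rung `BalabanLadder.UV` — nothing
continuum ∕ ℝ⁴ ∕ OS ∕ mass gap ∕ Clay.  Unit `pub-ymgap-dag-n06-w2` (g5), 2026-08-28.
-/

noncomputable section

open scoped BigOperators

namespace Literature.MathematicalPhysics.QuantumFieldTheory.Balaban1983to89.B9Thm31GpAgmonGradDivDecayClassZd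

open Literature.MathematicalPhysics.QuantumLattice (blockMap)
open B7Prop1Explicit (e)
open B7Eq78Linearization (conjR)
open B7Prop2Explicit (unitaryUnits pdev C0 c2')
open B8Ineq132 (covDerivFwd)
open B8Eq138LandauZd (covDivB)
open B8Eq119TwistedAxial (bgT)
open B8Eq131CubesAdmissible (cubeFam)
open B8LeafModelZd (ZdIdx)
open B8Eq191FlatLettersCubeMember (cubeLamS_finite)
open B9Thm311PosDefOpenZd (cubeMember_Ω0_finite)
open B9Eq319QQStarDiagonalZd (FullBlockGeometry fullBlockGeometry_cubeMember)
open B9Eq321LandauProjectionZd (suppSub formE formE_apply)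
open B9Eq324DeltaPrimeAZd (single restrictSite deltaPrimeADom GpZd)
open B9Eq325QprimeSingleSiteZd (blockMapIter)
open B9Eq342CombesThomasFormZd
open B9Eq324NearFlatFormComparisonZdTowerPairs (formE_deltaPrimeADom_one_le_near_flat')
open B9Thm31GpAgmonDecayNearFlatCubeZd (levelCoercive_of_comparison)
open B9Thm31NearFlatCoerciveCubeZd (fnorm_conjR_sub_le_of_cmp)
open B9Thm31NearFlatTransportersZd (bgT_mem_unitaryUnits_of_pdev norm_bgT_pair_sub_one_le sum_eps_sq_weight_le)
open B9Thm31GpAgmonGradDecayZd (levelData_one_cubeMember fnorm_covDerivFwd_GpZd_single_le_exp_coarse)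
open B9Thm31GpAgmonDivDecayZd (fnorm_GpZd_restrict_covDivB_le_of_grad)
open LatticeNorms (linfDist)

export B7Prop1Explicit (Site)

variable {d : ℕ} {𝔸 : Type*} [CStarAlgebra 𝔸]

variable (L : ℕ) (τ : 𝔸 →ₗ[ℂ] ℂ) [FiniteDimensional ℝ 𝔸] (hτp : ∀ a : 𝔸, a ≠ 0 → 0 < (τ (star a * a)).re)

/-! ## §1  The near-flat level data of a cube member, tower-pair letters -/

/-- ★★ **THE NEAR-FLAT LEVEL-DATA PACKAGE (tower-pair `τ`-letters).**  At a cube member (`2 ≤ L ≤ ρc`, `m ≤ i.k`, `ηLᵐ ≤ 1`) with print-scaled weights, a unitary `U₀`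
with `|R(U₀(x,μ))b − b|_τ ≤ θη|b|_τ`, unitary averaged transporters with `|R(Ū₀ⁱ(blockMap L w, w))b − b|_τ ≤ ε_i|b|_τ` (`i < m`), `a_j(Lᵈ)^{−j}(Σ_{i<j}ε_i)² ≤ κ_T`,
`4(dθ² + κ_T) ≤ m₈ = min{8, a_lo}`: there is a site mass `M ≥ 0` on `□₀` with `(1∕4)Σ_zM_z|Φ z|²_τ ≤ ⟨Φ, Δ′_a(U₀)Φ⟩_τ`, the scaling slots `η⁻²(Lᵐ)⁻² ≤ m₈⁻¹M`,
`Σ_{j≤m}𝟙[yʲ(z)∈Λ_j]a_j(Lᵈ)^{−j} ≤ a_hi m₈⁻¹M`, and the floor `m₈(ηLᵐ)⁻² ≤ M`.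
[cite: Balaban1985BackgroundPropagators, (3.24) p.394, Thm 3.1 p.397, Thm 3.11 p.416, (3.86) p.407; Balaban1985RegularSpaces, (1.131) p.99] -/
theorem levelData_cubeMember_tower [Nontrivial 𝔸] (hL : 2 ≤ L) (hτt : ∀ a b : 𝔸, τ (a * b) = τ (b * a))
    (hτs : ∀ a : 𝔸, τ (star a) = starRingEnd ℂ (τ a)) (i : ZdIdx d L) {ac : Site d} {Mc ρc : ℕ} (hΩ : i.Ω = cubeFam false L ac Mc ρc i.k)
    (hρc : L ≤ ρc) {m : ℕ} (hm : m ≤ i.k) (hηm : i.η * (L : ℝ) ^ m ≤ 1) {a : ℕ → ℝ} (ha : ∀ j, 0 ≤ a j) {a_lo a_hi : ℝ} (halo : 0 < a_lo)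
    (hlo : ∀ j ∈ Finset.range (m + 1), a_lo * ((L : ℝ) ^ d) ^ j * ((i.η * (L : ℝ) ^ j) ^ 2)⁻¹ ≤ a j)
    (hhi : ∀ j ∈ Finset.range (m + 1), a j ≤ a_hi * ((L : ℝ) ^ d) ^ j * ((i.η * (L : ℝ) ^ j) ^ 2)⁻¹)
    {U₀ : Site d → Fin d → 𝔸ˣ} (hU : ∀ (x : Site d) (κ' : Fin d), U₀ x κ' ∈ unitaryUnits 𝔸) {θ : ℝ}
    (hR : ∀ (x : Site d) (μ : Fin d) (b : 𝔸), fnorm τ (conjR (U₀ x μ) b - b) ≤ θ * i.η * fnorm τ b)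
    {ε : ℕ → ℝ} (hε : ∀ i', 0 ≤ ε i') (hT : ∀ i', i' < m → ∀ z y : Site d, bgT L U₀ i' z y ∈ unitaryUnits 𝔸)
    (hTε : ∀ i', i' < m → ∀ (w' : Site d) (b : 𝔸), fnorm τ (conjR (bgT L U₀ i' (blockMap L w') w') b - b) ≤ ε i' * fnorm τ b)
    {κT : ℝ} (hκT0 : 0 ≤ κT) (hκT : ∀ j ∈ Finset.range (m + 1), a j * ((((L : ℝ) ^ d) ^ j)⁻¹ * (∑ i' ∈ Finset.range j, ε i') ^ 2) ≤ κT)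
    (hsmall : 4 * (d * θ ^ 2 + κT) ≤ min 8 a_lo) :
    ∃ M : Site d → ℝ,
      (∀ z ∈ (cubeMember_Ω0_finite i hΩ).toFinset, 0 ≤ M z) ∧
      (∀ Φ : suppSub (𝔸 := 𝔸) (cubeMember_Ω0_finite i hΩ).toFinset,
        1 / 4 * ∑ z ∈ (cubeMember_Ω0_finite i hΩ).toFinset, M z * fnorm τ ((Φ : Site d → 𝔸) z) ^ 2 ≤
          formE τ (cubeMember_Ω0_finite i hΩ).toFinset Φ
            (deltaPrimeADom L U₀ i.η τ hτp m a (fun j => (cubeLamS_finite L ac Mc ρc i.k m j).toFinset)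
              (cubeMember_Ω0_finite i hΩ).toFinset Φ)) ∧
      (∀ z ∈ (cubeMember_Ω0_finite i hΩ).toFinset, (i.η⁻¹) ^ 2 * (((L : ℝ) ^ m)⁻¹) ^ 2 ≤ (min 8 a_lo)⁻¹ * M z) ∧
      (∀ z ∈ (cubeMember_Ω0_finite i hΩ).toFinset, ∑ j ∈ Finset.range (m + 1),
        (if blockMapIter L j z ∈ (fun j => (cubeLamS_finite L ac Mc ρc i.k m j).toFinset) j then a j * (((L : ℝ) ^ d)⁻¹) ^ j else 0) ≤
          a_hi * (min 8 a_lo)⁻¹ * M z) ∧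
      (∀ z ∈ (cubeMember_Ω0_finite i hΩ).toFinset, min 8 a_lo * ((i.η * (L : ℝ) ^ m) ^ 2)⁻¹ ≤ M z) := by
  classical
  haveI : NeZero L := ⟨by omega⟩
  have hL0 : (0 : ℝ) < L := by exact_mod_cast (lt_of_lt_of_le zero_lt_two hL)
  have hη0 : 0 < i.η := i.hη
  set S := (cubeMember_Ω0_finite i hΩ).toFinset with hS
  set Λ : ℕ → Finset (Site d) := fun j => (cubeLamS_finite L ac Mc ρc i.k m j).toFinset with hΛ
  set m₈ : ℝ := min 8 a_lo with hm₈
  have hm₈0 : 0 < m₈ := lt_min (by norm_num) halo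
  obtain ⟨M, hM0, hflat1, hB, hA, hfloor⟩ := levelData_one_cubeMember L τ hτp hL hτt hτs i hΩ hρc hm ha halo hlo hhi
  have hflat : ∀ Φ : suppSub (𝔸 := 𝔸) S, ∑ z ∈ S, M z * fnorm τ ((Φ : Site d → 𝔸) z) ^ 2 ≤
      formE τ S Φ (deltaPrimeADom L (1 : Site d → Fin d → 𝔸ˣ) i.η τ hτp m a Λ S Φ) := fun Φ => by
    have h := hflat1 Φ
    rwa [one_mul] at h
  -- the floor `μ₀ = m₈(ηLᵐ)⁻²` and `m₈ ≤ μ₀` (`ηLᵐ ≤ 1`)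
  set μ₀ : ℝ := m₈ * ((i.η * (L : ℝ) ^ m) ^ 2)⁻¹ with hμ₀
  have hμ₀pos : 0 < μ₀ := by positivity
  have hm₈μ₀ : m₈ ≤ μ₀ := by
    rw [hμ₀]
    have h1 : (i.η * (L : ℝ) ^ m) ^ 2 ≤ 1 := by
      have h0 : 0 ≤ i.η * (L : ℝ) ^ m := by positivity
      nlinarith
    have h2 : 1 ≤ ((i.η * (L : ℝ) ^ m) ^ 2)⁻¹ := one_le_inv_iff₀.2 ⟨by positivity, h1⟩
    nlinarith
  -- the near-flat comparison on the tower pairs (dag-n06-w4 g5) and the transfer (FILE 7)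
  have hG : FullBlockGeometry L m Λ S := fullBlockGeometry_cubeMember i hΩ hρc hm
  have hdisj : ∀ j ∈ Finset.range (m + 1), ∀ y' ∈ Λ j, ∀ i' ∈ Finset.range (m + 1), ∀ y'' ∈ Λ i', (i', y'') ≠ (j, y') →
      ∀ z : Site d, blockMapIter L j z = y' → blockMapIter L i' z ≠ y'' := fun j hj y' hy' => (hG j hj y' hy').2
  have hcmp : ∀ Φ : suppSub (𝔸 := 𝔸) S, formE τ S Φ (deltaPrimeADom L (1 : Site d → Fin d → 𝔸ˣ) i.η τ hτp m a Λ S Φ) ≤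
      2 * formE τ S Φ (deltaPrimeADom L U₀ i.η τ hτp m a Λ S Φ) + 2 * (d * θ ^ 2 + κT) * formE τ S Φ Φ := fun Φ =>
    formE_deltaPrimeADom_one_le_near_flat' τ hτp hτt hτs hη0 hU hR m ha Λ hdisj hε hT hTε hκT0 hκT Φ
  have hE0 : 0 ≤ d * θ ^ 2 + κT := by positivity
  have hco : ∀ Φ : suppSub (𝔸 := 𝔸) S, 1 / 4 * ∑ z ∈ S, M z * fnorm τ ((Φ : Site d → 𝔸) z) ^ 2 ≤
      formE τ S Φ (deltaPrimeADom L U₀ i.η τ hτp m a Λ S Φ) := fun Φ =>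
    levelCoercive_of_comparison hτp hμ₀pos hE0 (hsmall.trans hm₈μ₀) hfloor hflat hcmp Φ
  exact ⟨M, hM0, hco, hB, hA, hfloor⟩

/-! ## §2  The same package on the small-plaquette class -/

/-- ★★ **THE LEVEL-DATA PACKAGE ON THE CLASS.**  At a cube member (`2 ≤ L ≤ ρc`, `m ≤ i.k`, `ηLᵐ ≤ 1`, `L^{−k} ≤ η`) with print-scaled weights, fibre-norm comparison
`|a|_τ ≤ C_u‖a‖`, `‖a‖ ≤ C_l|a|_τ`, a unitary `U₀` with `pdev U₀ < α₀(L^{−k})²` (`0 < α₀`, `C0 d α₀ ≤ 1∕3`, `2α₀ ≤ c2′ d L`) and `‖U₀(x,μ) − 1‖ ≤ θ′η` (`θ′ ≥ 0`), and the CLASS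
smallness `4(2C_uC_l)²(dθ′² + a_hi d²L²(256(d+1)(d+4)α₀ + θ′)²) ≤ m₈`: the conclusions of `levelData_cubeMember_tower` hold (coercivity constant `1∕4`).
[cite: Balaban1985BackgroundPropagators, (3.24) p.394, Thm 3.1 p.397, Thm 3.11 p.416; Balaban1985Averaging, Prop. 2 p.26, (122)–(126) p.36; Balaban1985RegularSpaces, (1.131) p.99] -/
theorem levelData_cubeMember_of_class [Nontrivial 𝔸] (hL : 2 ≤ L) (hτt : ∀ a b : 𝔸, τ (a * b) = τ (b * a))
    (hτs : ∀ a : 𝔸, τ (star a) = starRingEnd ℂ (τ a)) {Cu Cl : ℝ} (hCu : ∀ a : 𝔸, fnorm τ a ≤ Cu * ‖a‖) (hCl : ∀ a : 𝔸, ‖a‖ ≤ Cl * fnorm τ a)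
    (hCu0 : 0 ≤ Cu) (hCl0 : 0 ≤ Cl) (i : ZdIdx d L) {ac : Site d} {Mc ρc : ℕ} (hΩ : i.Ω = cubeFam false L ac Mc ρc i.k)
    (hρc : L ≤ ρc) {m : ℕ} (hm : m ≤ i.k) (hηm : i.η * (L : ℝ) ^ m ≤ 1) (hkη : ((L : ℝ) ^ i.k)⁻¹ ≤ i.η)
    {a : ℕ → ℝ} (ha : ∀ j, 0 ≤ a j) {a_lo a_hi : ℝ} (halo : 0 < a_lo)
    (hlo : ∀ j ∈ Finset.range (m + 1), a_lo * ((L : ℝ) ^ d) ^ j * ((i.η * (L : ℝ) ^ j) ^ 2)⁻¹ ≤ a j)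
    (hhi : ∀ j ∈ Finset.range (m + 1), a j ≤ a_hi * ((L : ℝ) ^ d) ^ j * ((i.η * (L : ℝ) ^ j) ^ 2)⁻¹)
    {U₀ : Site d → Fin d → 𝔸ˣ} (hU : ∀ (x : Site d) (κ' : Fin d), U₀ x κ' ∈ unitaryUnits 𝔸)
    {α₀ : ℝ} (hα : 0 < α₀) (hα3 : C0 d * α₀ ≤ 1 / 3) (hα2 : 2 * α₀ ≤ c2' d L) (h52 : pdev U₀ < α₀ * (((L : ℝ) ^ i.k)⁻¹) ^ 2)
    {θ' : ℝ} (hθ' : 0 ≤ θ') (hR : ∀ (x : Site d) (μ : Fin d), ‖((U₀ x μ : 𝔸ˣ) : 𝔸) - 1‖ ≤ θ' * i.η)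
    (hsmall : 4 * ((2 * Cu * Cl) ^ 2 * (d * θ' ^ 2 + a_hi * d ^ 2 * (L : ℝ) ^ 2 * (256 * (d + 1) * (d + 4) * α₀ + θ') ^ 2)) ≤ min 8 a_lo) :
    ∃ M : Site d → ℝ,
      (∀ z ∈ (cubeMember_Ω0_finite i hΩ).toFinset, 0 ≤ M z) ∧
      (∀ Φ : suppSub (𝔸 := 𝔸) (cubeMember_Ω0_finite i hΩ).toFinset,
        1 / 4 * ∑ z ∈ (cubeMember_Ω0_finite i hΩ).toFinset, M z * fnorm τ ((Φ : Site d → 𝔸) z) ^ 2 ≤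
          formE τ (cubeMember_Ω0_finite i hΩ).toFinset Φ
            (deltaPrimeADom L U₀ i.η τ hτp m a (fun j => (cubeLamS_finite L ac Mc ρc i.k m j).toFinset)
              (cubeMember_Ω0_finite i hΩ).toFinset Φ)) ∧
      (∀ z ∈ (cubeMember_Ω0_finite i hΩ).toFinset, (i.η⁻¹) ^ 2 * (((L : ℝ) ^ m)⁻¹) ^ 2 ≤ (min 8 a_lo)⁻¹ * M z) ∧
      (∀ z ∈ (cubeMember_Ω0_finite i hΩ).toFinset, ∑ j ∈ Finset.range (m + 1),
        (if blockMapIter L j z ∈ (fun j => (cubeLamS_finite L ac Mc ρc i.k m j).toFinset) j then a j * (((L : ℝ) ^ d)⁻¹) ^ j else 0) ≤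
          a_hi * (min 8 a_lo)⁻¹ * M z) ∧
      (∀ z ∈ (cubeMember_Ω0_finite i hΩ).toFinset, min 8 a_lo * ((i.η * (L : ℝ) ^ m) ^ 2)⁻¹ ≤ M z) := by
  have hL1 : 1 ≤ L := le_trans one_le_two hL
  have hL0 : (0 : ℝ) < L := by exact_mod_cast (lt_of_lt_of_le zero_lt_two hL)
  have hη0 : 0 < i.η := i.hη
  set C : ℝ := 2 * Cu * Cl with hC
  have hC0 : 0 ≤ C := by positivity
  -- the transporters of the class: unitary and close to `1` on the tower pairs (dag-n06-w4 g5)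
  have hT : ∀ i', i' < m → ∀ z y' : Site d, bgT L U₀ i' z y' ∈ unitaryUnits 𝔸 := fun i' hi' z y' =>
    bgT_mem_unitaryUnits_of_pdev hL i.k hU hα hα3 hα2 h52 (by omega) z y'
  set ε' : ℕ → ℝ := fun i' => d * L * (256 * (d + 1) * (d + 4) * α₀ * ((L : ℝ) ^ i' * ((L : ℝ) ^ i.k)⁻¹) ^ 2 + (L : ℝ) ^ i' * (θ' * i.η)) with hε'
  have hε'0 : ∀ i', 0 ≤ ε' i' := fun i' => by positivity
  have hδ0 : 0 ≤ θ' * i.η := by positivity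
  have hTε : ∀ i', i' < m → ∀ (w' : Site d), ‖((bgT L U₀ i' (blockMap L w') w' : 𝔸ˣ) : 𝔸) - 1‖ ≤ ε' i' := fun i' hi' w' =>
    norm_bgT_pair_sub_one_le hL i.k hU hα hα3 hα2 h52 hδ0 hR (by omega) w'
  -- the τ-size letters (`θ := Cθ′`, `ε := Cε′`)
  have hRτ : ∀ (x : Site d) (μ : Fin d) (b : 𝔸), fnorm τ (conjR (U₀ x μ) b - b) ≤ (C * θ') * i.η * fnorm τ b := by
    intro x μ b
    refine (fnorm_conjR_sub_le_of_cmp τ hCu hCl hCu0 (hU x μ) b).trans ?_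
    rw [← hC]
    have hb := fnorm_nonneg τ b
    calc C * ‖((U₀ x μ : 𝔸ˣ) : 𝔸) - 1‖ * fnorm τ b ≤ C * (θ' * i.η) * fnorm τ b :=
          mul_le_mul_of_nonneg_right (mul_le_mul_of_nonneg_left (hR x μ) hC0) hb
      _ = (C * θ') * i.η * fnorm τ b := by ring
  have hTτ : ∀ i', i' < m → ∀ (w' : Site d) (b : 𝔸), fnorm τ (conjR (bgT L U₀ i' (blockMap L w') w') b - b) ≤ (C * ε' i') * fnorm τ b := by
    intro i' hi' w' b
    refine (fnorm_conjR_sub_le_of_cmp τ hCu hCl hCu0 (hT i' hi' _ _) b).trans ?_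
    rw [← hC]
    exact mul_le_mul_of_nonneg_right (mul_le_mul_of_nonneg_left (hTε i' hi' w') hC0) (fnorm_nonneg τ b)
  -- the scale-free weight bound `κ′_T` (dag-n06-w4 g5)
  have hηL : ∀ j ∈ Finset.range (m + 1), i.η * (L : ℝ) ^ j ≤ 1 := by
    intro j hj
    have hjm : j ≤ m := Nat.lt_succ_iff.1 (Finset.mem_range.1 hj)
    have hLj : (L : ℝ) ^ j ≤ (L : ℝ) ^ m := pow_le_pow_right₀ (by exact_mod_cast hL1) hjm
    calc i.η * (L : ℝ) ^ j ≤ i.η * (L : ℝ) ^ m := mul_le_mul_of_nonneg_left hLj hη0.le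
      _ ≤ 1 := hηm
  have haA : ∀ j ∈ Finset.range (m + 1), a j * i.η ^ 2 * ((L : ℝ) ^ j) ^ 2 ≤ a_hi * ((L : ℝ) ^ j) ^ d := by
    intro j hj
    have h := hhi j hj
    have hpos : 0 < (i.η * (L : ℝ) ^ j) ^ 2 := by positivity
    have hpow : ((L : ℝ) ^ d) ^ j = ((L : ℝ) ^ j) ^ d := by rw [← pow_mul, ← pow_mul, mul_comm]
    calc a j * i.η ^ 2 * ((L : ℝ) ^ j) ^ 2 = a j * (i.η * (L : ℝ) ^ j) ^ 2 := by ring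
      _ ≤ a_hi * ((L : ℝ) ^ d) ^ j * ((i.η * (L : ℝ) ^ j) ^ 2)⁻¹ * (i.η * (L : ℝ) ^ j) ^ 2 := mul_le_mul_of_nonneg_right h hpos.le
      _ = a_hi * ((L : ℝ) ^ j) ^ d := by rw [mul_assoc, inv_mul_cancel₀ hpos.ne', mul_one, hpow]
  have hκT : ∀ j ∈ Finset.range (m + 1), a j * ((((L : ℝ) ^ d) ^ j)⁻¹ * (∑ i' ∈ Finset.range j, ε' i') ^ 2) ≤
      a_hi * d ^ 2 * (L : ℝ) ^ 2 * (256 * (d + 1) * (d + 4) * α₀ + θ') ^ 2 := fun j hj =>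
    sum_eps_sq_weight_le hL hη0 hkη hηL hθ' hα.le ha haA hj
  have hκτ : ∀ j ∈ Finset.range (m + 1), a j * ((((L : ℝ) ^ d) ^ j)⁻¹ * (∑ i' ∈ Finset.range j, C * ε' i') ^ 2) ≤
      C ^ 2 * (a_hi * d ^ 2 * (L : ℝ) ^ 2 * (256 * (d + 1) * (d + 4) * α₀ + θ') ^ 2) := by
    intro j hj
    rw [← Finset.mul_sum, mul_pow]
    calc a j * ((((L : ℝ) ^ d) ^ j)⁻¹ * (C ^ 2 * (∑ i' ∈ Finset.range j, ε' i') ^ 2))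
        = C ^ 2 * (a j * ((((L : ℝ) ^ d) ^ j)⁻¹ * (∑ i' ∈ Finset.range j, ε' i') ^ 2)) := by ring
      _ ≤ C ^ 2 * (a_hi * d ^ 2 * (L : ℝ) ^ 2 * (256 * (d + 1) * (d + 4) * α₀ + θ') ^ 2) := mul_le_mul_of_nonneg_left (hκT j hj) (sq_nonneg C)
  have hahi0 : 0 ≤ a_hi := by
    have h0 := hlo 0 (Finset.mem_range.2 (Nat.succ_pos m))
    have h1 := hhi 0 (Finset.mem_range.2 (Nat.succ_pos m))
    have hpos : 0 < ((L : ℝ) ^ d) ^ 0 * ((i.η * (L : ℝ) ^ 0) ^ 2)⁻¹ := by positivity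
    have : a_lo * ((L : ℝ) ^ d) ^ 0 * ((i.η * (L : ℝ) ^ 0) ^ 2)⁻¹ ≤ a_hi * ((L : ℝ) ^ d) ^ 0 * ((i.η * (L : ℝ) ^ 0) ^ 2)⁻¹ := h0.trans h1
    rw [mul_assoc, mul_assoc] at this
    nlinarith [le_of_mul_le_mul_right this hpos]
  have hκT0' : 0 ≤ C ^ 2 * (a_hi * d ^ 2 * (L : ℝ) ^ 2 * (256 * (d + 1) * (d + 4) * α₀ + θ') ^ 2) := by positivity
  have hsmall' : 4 * (d * (C * θ') ^ 2 + C ^ 2 * (a_hi * d ^ 2 * (L : ℝ) ^ 2 * (256 * (d + 1) * (d + 4) * α₀ + θ') ^ 2)) ≤ min 8 a_lo := by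
    have : 4 * (d * (C * θ') ^ 2 + C ^ 2 * (a_hi * d ^ 2 * (L : ℝ) ^ 2 * (256 * (d + 1) * (d + 4) * α₀ + θ') ^ 2)) =
        4 * ((2 * Cu * Cl) ^ 2 * (d * θ' ^ 2 + a_hi * d ^ 2 * (L : ℝ) ^ 2 * (256 * (d + 1) * (d + 4) * α₀ + θ') ^ 2)) := by rw [hC]; ring
    rw [this]; exact hsmall
  exact levelData_cubeMember_tower L τ hτp hL hτt hτs i hΩ hρc hm hηm ha halo hlo hhi hU hRτ (fun i' => mul_nonneg hC0 (hε'0 i')) hT hTτ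
    hκT0' hκτ hsmall'

/-! ## §3  Entry `n = 1` on the class -/

/-- ★★★ **[B9] THM 3.1's (3.42), n = 1 SHAPE, FOR `G′(U₀)` AT EVERY CUBE MEMBER AND EVERY BACKGROUND OF THE SMALL-PLAQUETTE CLASS — MEMBER-UNIFORM EXPLICIT CONSTANTS.**
Data of `levelData_cubeMember_of_class` and `0 ≤ κ ≤ 1` with `κ(48d + 120a_hi) ≤ m₈`.  THEN for every direction `μ`, all `y ∈ □₀` and all `x` with `x + e_μ ∈ □₀`:
`|(D^η_{U₀,μ}G′(U₀)δ_y w)(x)|_τ ≤ (24∕√m₈)·(ηLᵐ)·e^{−κL^{−m}|x−y|_∞}·|w|_τ` — print's `B₀·Lʲη·e^{−δ₀d(y,y′)}|λ|` at the coarsest scale, `B₀ = 24∕√m₈`, `δ₀ = κ`.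
[cite: Balaban1985BackgroundPropagators, Thm 3.1 p.397, (3.42) p.397, Thm 3.11 p.416, (3.24) p.394; Balaban1985Averaging, Prop. 2 p.26, (122)–(126) p.36; Balaban1985RegularSpaces, (1.131) p.99; Agmon1982, Thm 1.5 p.19] -/
theorem fnorm_covDerivFwd_GpZd_single_le_exp_cubeMember_of_class [Nontrivial 𝔸] (hd : 0 < d) (hL : 2 ≤ L) (hτt : ∀ a b : 𝔸, τ (a * b) = τ (b * a))
    (hτs : ∀ a : 𝔸, τ (star a) = starRingEnd ℂ (τ a)) {Cu Cl : ℝ} (hCu : ∀ a : 𝔸, fnorm τ a ≤ Cu * ‖a‖) (hCl : ∀ a : 𝔸, ‖a‖ ≤ Cl * fnorm τ a)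
    (hCu0 : 0 ≤ Cu) (hCl0 : 0 ≤ Cl) (i : ZdIdx d L) {ac : Site d} {Mc ρc : ℕ} (hΩ : i.Ω = cubeFam false L ac Mc ρc i.k)
    (hρc : L ≤ ρc) {m : ℕ} (hm : m ≤ i.k) (hηm : i.η * (L : ℝ) ^ m ≤ 1) (hkη : ((L : ℝ) ^ i.k)⁻¹ ≤ i.η)
    {a : ℕ → ℝ} (ha : ∀ j, 0 ≤ a j) {a_lo a_hi : ℝ} (halo : 0 < a_lo)
    (hlo : ∀ j ∈ Finset.range (m + 1), a_lo * ((L : ℝ) ^ d) ^ j * ((i.η * (L : ℝ) ^ j) ^ 2)⁻¹ ≤ a j)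
    (hhi : ∀ j ∈ Finset.range (m + 1), a j ≤ a_hi * ((L : ℝ) ^ d) ^ j * ((i.η * (L : ℝ) ^ j) ^ 2)⁻¹)
    {U₀ : Site d → Fin d → 𝔸ˣ} (hU : ∀ (x : Site d) (κ' : Fin d), U₀ x κ' ∈ unitaryUnits 𝔸)
    {α₀ : ℝ} (hα : 0 < α₀) (hα3 : C0 d * α₀ ≤ 1 / 3) (hα2 : 2 * α₀ ≤ c2' d L) (h52 : pdev U₀ < α₀ * (((L : ℝ) ^ i.k)⁻¹) ^ 2)
    {θ' : ℝ} (hθ' : 0 ≤ θ') (hR : ∀ (x : Site d) (μ : Fin d), ‖((U₀ x μ : 𝔸ˣ) : 𝔸) - 1‖ ≤ θ' * i.η)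
    (hsmall : 4 * ((2 * Cu * Cl) ^ 2 * (d * θ' ^ 2 + a_hi * d ^ 2 * (L : ℝ) ^ 2 * (256 * (d + 1) * (d + 4) * α₀ + θ') ^ 2)) ≤ min 8 a_lo)
    {κ : ℝ} (hκ0 : 0 ≤ κ) (hκ1 : κ ≤ 1) (hκ : κ * (48 * d + 120 * a_hi) ≤ min 8 a_lo) (μ : Fin d)
    {x y : Site d} (hx : x + e μ ∈ (cubeMember_Ω0_finite i hΩ).toFinset) (hy : y ∈ (cubeMember_Ω0_finite i hΩ).toFinset) (w : 𝔸) :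
    fnorm τ (covDerivFwd i.η U₀ μ
        (GpZd L U₀ i.η τ hτp m a (fun j => (cubeLamS_finite L ac Mc ρc i.k m j).toFinset)
          (cubeMember_Ω0_finite i hΩ).toFinset hd i.hη.ne' hτt hτs hU ha
          (restrictSite (cubeMember_Ω0_finite i hΩ).toFinset (single y w)) : Site d → 𝔸) x) ≤
      24 / Real.sqrt (min 8 a_lo) * (i.η * (L : ℝ) ^ m) * Real.exp (-(κ * (((L : ℝ) ^ m)⁻¹ * ((linfDist x y : ℕ) : ℝ)))) * fnorm τ w := by
  haveI : NeZero L := ⟨by omega⟩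
  have hL1 : 1 ≤ L := le_trans one_le_two hL
  have hL0 : (0 : ℝ) < L := by exact_mod_cast (lt_of_lt_of_le zero_lt_two hL)
  have hη0 : 0 < i.η := i.hη
  set m₈ : ℝ := min 8 a_lo with hm₈
  have hm₈0 : 0 < m₈ := lt_min (by norm_num) halo
  have hm₈8 : m₈ ≤ 8 := min_le_left _ _
  have hahi0 : 0 ≤ a_hi := by
    have h0 := hlo 0 (Finset.mem_range.2 (Nat.succ_pos m))
    have h1 := hhi 0 (Finset.mem_range.2 (Nat.succ_pos m))
    have hpos : 0 < ((L : ℝ) ^ d) ^ 0 * ((i.η * (L : ℝ) ^ 0) ^ 2)⁻¹ := by positivity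
    have : a_lo * ((L : ℝ) ^ d) ^ 0 * ((i.η * (L : ℝ) ^ 0) ^ 2)⁻¹ ≤ a_hi * ((L : ℝ) ^ d) ^ 0 * ((i.η * (L : ℝ) ^ 0) ^ 2)⁻¹ := h0.trans h1
    rw [mul_assoc, mul_assoc] at this
    nlinarith [le_of_mul_le_mul_right this hpos]
  have hT : ∀ i', i' < m → ∀ z y' : Site d, bgT L U₀ i' z y' ∈ unitaryUnits 𝔸 := fun i' hi' z y' =>
    bgT_mem_unitaryUnits_of_pdev hL i.k hU hα hα3 hα2 h52 (by omega) z y'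
  obtain ⟨M, hM0, hco, hB, hA, -⟩ := levelData_cubeMember_of_class L τ hτp hL hτt hτs hCu hCl hCu0 hCl0 i hΩ hρc hm hηm hkη ha halo hlo hhi hU
    hα hα3 hα2 h52 hθ' hR hsmall
  -- the window with `θ_A = 1∕2`, `c₀ = 1∕4`, `B = m₈⁻¹`, `A = a_hi m₈⁻¹`
  have hκ' : κ * (6 * d * m₈⁻¹ + 15 * (a_hi * m₈⁻¹)) ≤ 1 / 2 * (1 / 4) := by
    have h1 : κ * (6 * d * m₈⁻¹ + 15 * (a_hi * m₈⁻¹)) = (κ * (48 * d + 120 * a_hi)) / (8 * m₈) := by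
      field_simp
      ring
    rw [h1, div_le_iff₀ (by positivity), show (1 : ℝ) / 2 * (1 / 4) * (8 * m₈) = m₈ by ring]
    exact hκ
  have hmain := fnorm_covDerivFwd_GpZd_single_le_exp_coarse L U₀ i.η τ hτp m a
    (fun j => (cubeLamS_finite L ac Mc ρc i.k m j).toFinset) (cubeMember_Ω0_finite i hΩ).toFinset hd i.hη.ne' hL1 hτt hτs hU hT ha
    (by norm_num : (0 : ℝ) < 1 / 4) (by norm_num : (0 : ℝ) ≤ 1 / 2) (by norm_num : (1 : ℝ) / 2 < 1) hM0 hco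
    (inv_pos.2 hm₈0) hκ0 hκ1 hκ' hB hA hη0 hy w μ hx
  refine hmain.trans ?_
  -- the amplitude: `4√(m₈⁻¹(1∕4 + 9κ²m₈⁻¹))∕((1∕2)(1∕4)) ≤ 24∕√m₈` since `9κ²m₈⁻¹ ≤ 5∕16` (indeed `≤ 1∕32`)
  have hκm : 48 * κ ≤ m₈ := by
    have hd1 : (1 : ℝ) ≤ d := by exact_mod_cast hd
    have h48 : (48 : ℝ) ≤ 48 * d + 120 * a_hi := by linarith only [hd1, hahi0]
    have h := mul_le_mul_of_nonneg_left h48 hκ0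
    linarith only [h, hκ]
  have hX : m₈⁻¹ * (1 / 4 + 9 * κ ^ 2 * m₈⁻¹) ≤ 9 / 16 * m₈⁻¹ := by
    have hinv : 0 < m₈⁻¹ := inv_pos.2 hm₈0
    have h9 : 9 * κ ^ 2 * m₈⁻¹ ≤ 5 / 16 := by
      rw [show 9 * κ ^ 2 * m₈⁻¹ = 9 * κ ^ 2 / m₈ by ring, div_le_iff₀ hm₈0]
      have h1 := mul_le_mul_of_nonneg_left hκm hκ0
      rw [show κ * (48 * κ) = 48 * κ ^ 2 by ring] at h1
      have h2 := mul_le_mul_of_nonneg_right hκ1 hm₈0.le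
      rw [one_mul] at h2
      linarith only [h1, h2, hm₈0]
    calc m₈⁻¹ * (1 / 4 + 9 * κ ^ 2 * m₈⁻¹) ≤ m₈⁻¹ * (1 / 4 + 5 / 16) := by
          refine mul_le_mul_of_nonneg_left ?_ hinv.le; linarith only [h9]
      _ = 9 / 16 * m₈⁻¹ := by ring
  have hsqrt : Real.sqrt (m₈⁻¹ * (1 / 4 + 9 * κ ^ 2 * m₈⁻¹)) ≤ 3 / 4 * (Real.sqrt m₈)⁻¹ := by
    refine (Real.sqrt_le_sqrt hX).trans (le_of_eq ?_)
    rw [Real.sqrt_mul (by norm_num), Real.sqrt_inv, show (9 / 16 : ℝ) = (3 / 4) ^ 2 by norm_num, Real.sqrt_sq (by norm_num)]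
  have hE := Real.exp_pos (-(κ * (((L : ℝ) ^ m)⁻¹ * ((linfDist x y : ℕ) : ℝ))))
  have hw0 := fnorm_nonneg τ w
  have hηL : 0 < i.η * (L : ℝ) ^ m := by positivity
  have hamp : 4 * Real.sqrt (m₈⁻¹ * (1 / 4 + 9 * κ ^ 2 * m₈⁻¹)) / ((1 - 1 / 2) * (1 / 4)) ≤ 24 / Real.sqrt m₈ := by
    rw [show ((1 : ℝ) - 1 / 2) * (1 / 4) = 1 / 8 by norm_num]
    have hs0 : 0 < Real.sqrt m₈ := Real.sqrt_pos.2 hm₈0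
    calc 4 * Real.sqrt (m₈⁻¹ * (1 / 4 + 9 * κ ^ 2 * m₈⁻¹)) / (1 / 8) = 32 * Real.sqrt (m₈⁻¹ * (1 / 4 + 9 * κ ^ 2 * m₈⁻¹)) := by ring
      _ ≤ 32 * (3 / 4 * (Real.sqrt m₈)⁻¹) := mul_le_mul_of_nonneg_left hsqrt (by norm_num)
      _ = 24 / Real.sqrt m₈ := by field_simp; ring
  gcongr

/-! ## §4  Entry `n = 2` on the class -/

/-- ★★★ **[B9] THM 3.1's (3.42), n = 2 SHAPE, FOR `G′(U₀)` AT EVERY CUBE MEMBER AND EVERY BACKGROUND OF THE SMALL-PLAQUETTE CLASS.**  Data of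
`fnorm_covDerivFwd_GpZd_single_le_exp_cubeMember_of_class`; a bond field `A` carried by `T` with bond heads in `□₀`; `x ∈ □₀`.  THEN
`|(G′(U₀)𝟙_{□₀}D^{η*}_{U₀}A)(x)|_τ ≤ (24∕√m₈)·(ηLᵐ)·Σ_μΣ_{y∈T} e^{−κL^{−m}|y−x|_∞}·|A(y,μ)|_τ`.
[cite: Balaban1985BackgroundPropagators, Thm 3.1 p.397, (3.42) p.397 (third entry), p.391, Thm 3.11 p.416; Balaban1985Averaging, Prop. 2 p.26; Balaban1985RegularSpaces, (1.131) p.99; Agmon1982, Thm 1.5 p.19] -/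
theorem fnorm_GpZd_restrict_covDivB_le_exp_cubeMember_of_class [Nontrivial 𝔸] (hd : 0 < d) (hL : 2 ≤ L) (hτt : ∀ a b : 𝔸, τ (a * b) = τ (b * a))
    (hτs : ∀ a : 𝔸, τ (star a) = starRingEnd ℂ (τ a)) {Cu Cl : ℝ} (hCu : ∀ a : 𝔸, fnorm τ a ≤ Cu * ‖a‖) (hCl : ∀ a : 𝔸, ‖a‖ ≤ Cl * fnorm τ a)
    (hCu0 : 0 ≤ Cu) (hCl0 : 0 ≤ Cl) (i : ZdIdx d L) {ac : Site d} {Mc ρc : ℕ} (hΩ : i.Ω = cubeFam false L ac Mc ρc i.k)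
    (hρc : L ≤ ρc) {m : ℕ} (hm : m ≤ i.k) (hηm : i.η * (L : ℝ) ^ m ≤ 1) (hkη : ((L : ℝ) ^ i.k)⁻¹ ≤ i.η)
    {a : ℕ → ℝ} (ha : ∀ j, 0 ≤ a j) {a_lo a_hi : ℝ} (halo : 0 < a_lo)
    (hlo : ∀ j ∈ Finset.range (m + 1), a_lo * ((L : ℝ) ^ d) ^ j * ((i.η * (L : ℝ) ^ j) ^ 2)⁻¹ ≤ a j)
    (hhi : ∀ j ∈ Finset.range (m + 1), a j ≤ a_hi * ((L : ℝ) ^ d) ^ j * ((i.η * (L : ℝ) ^ j) ^ 2)⁻¹)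
    {U₀ : Site d → Fin d → 𝔸ˣ} (hU : ∀ (x : Site d) (κ' : Fin d), U₀ x κ' ∈ unitaryUnits 𝔸)
    {α₀ : ℝ} (hα : 0 < α₀) (hα3 : C0 d * α₀ ≤ 1 / 3) (hα2 : 2 * α₀ ≤ c2' d L) (h52 : pdev U₀ < α₀ * (((L : ℝ) ^ i.k)⁻¹) ^ 2)
    {θ' : ℝ} (hθ' : 0 ≤ θ') (hR : ∀ (x : Site d) (μ : Fin d), ‖((U₀ x μ : 𝔸ˣ) : 𝔸) - 1‖ ≤ θ' * i.η)
    (hsmall : 4 * ((2 * Cu * Cl) ^ 2 * (d * θ' ^ 2 + a_hi * d ^ 2 * (L : ℝ) ^ 2 * (256 * (d + 1) * (d + 4) * α₀ + θ') ^ 2)) ≤ min 8 a_lo)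
    {κ : ℝ} (hκ0 : 0 ≤ κ) (hκ1 : κ ≤ 1) (hκ : κ * (48 * d + 120 * a_hi) ≤ min 8 a_lo)
    {A : Site d → Fin d → 𝔸} {T : Finset (Site d)} (hTA : ∀ (y : Site d) (μ : Fin d), A y μ ≠ 0 → y ∈ T)
    (hhead : ∀ (y : Site d) (μ : Fin d), A y μ ≠ 0 → y + e μ ∈ (cubeMember_Ω0_finite i hΩ).toFinset)
    {x : Site d} (hx : x ∈ (cubeMember_Ω0_finite i hΩ).toFinset) :
    fnorm τ ((GpZd L U₀ i.η τ hτp m a (fun j => (cubeLamS_finite L ac Mc ρc i.k m j).toFinset)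
        (cubeMember_Ω0_finite i hΩ).toFinset hd i.hη.ne' hτt hτs hU ha
        (restrictSite (cubeMember_Ω0_finite i hΩ).toFinset (covDivB i.η U₀ A)) : Site d → 𝔸) x) ≤
      24 / Real.sqrt (min 8 a_lo) * (i.η * (L : ℝ) ^ m) *
        ∑ μ : Fin d, ∑ y ∈ T, Real.exp (-(κ * (((L : ℝ) ^ m)⁻¹ * ((linfDist y x : ℕ) : ℝ)))) * fnorm τ (A y μ) := by
  have hL0 : (0 : ℝ) < L := by exact_mod_cast (lt_of_lt_of_le zero_lt_two hL)
  have hm₈0 : 0 < min 8 a_lo := lt_min (by norm_num) halo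
  set c : ℝ := 24 / Real.sqrt (min 8 a_lo) * (i.η * (L : ℝ) ^ m) with hc
  have hcpos : 0 ≤ c := by
    have := i.hη
    have : 0 < Real.sqrt (min 8 a_lo) := Real.sqrt_pos.2 hm₈0
    positivity
  have h := fnorm_GpZd_restrict_covDivB_le_of_grad L U₀ i.η τ hτp m a
    (fun j => (cubeLamS_finite L ac Mc ρc i.k m j).toFinset) (cubeMember_Ω0_finite i hΩ).toFinset hd i.hη.ne' hτt hτs hU ha hTA hx
    (K := fun y _ => c * Real.exp (-(κ * (((L : ℝ) ^ m)⁻¹ * ((linfDist y x : ℕ) : ℝ)))))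
    (fun y μ => mul_nonneg hcpos (Real.exp_pos _).le)
    (fun v y μ hyμ => by
      have hg := fnorm_covDerivFwd_GpZd_single_le_exp_cubeMember_of_class L τ hτp hd hL hτt hτs hCu hCl hCu0 hCl0 i hΩ hρc hm hηm hkη ha halo
        hlo hhi hU hα hα3 hα2 h52 hθ' hR hsmall hκ0 hκ1 hκ μ (hhead y μ hyμ) hx v
      simpa only [hc, mul_assoc] using hg)
  refine h.trans (le_of_eq ?_)
  rw [Finset.mul_sum]
  refine Finset.sum_congr rfl fun μ _ => ?_
  rw [Finset.mul_sum]
  refine Finset.sum_congr rfl fun y _ => ?_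
  ring

/-- ★★ **ONE BOND ON THE CLASS** — PRINT'S DISPLAY OF THE THIRD ENTRY: for the bond field carrying `X` on `b = (z, z + e_ν)` (`z + e_ν ∈ □₀`) and `x ∈ □₀`,
`|(G′(U₀)𝟙_{□₀}D^{η*}_{U₀}δ_b X)(x)|_τ ≤ (24∕√m₈)·(ηLᵐ)·e^{−κL^{−m}|z−x|_∞}·|X|_τ`.
[cite: Balaban1985BackgroundPropagators, Thm 3.1 p.397, (3.42) p.397 (third entry), Thm 3.11 p.416; Balaban1985Averaging, Prop. 2 p.26; Balaban1985RegularSpaces, (1.131) p.99; Agmon1982, Thm 1.5 p.19] -/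
theorem fnorm_GpZd_restrict_covDivB_bond_le_exp_cubeMember_of_class [Nontrivial 𝔸] (hd : 0 < d) (hL : 2 ≤ L) (hτt : ∀ a b : 𝔸, τ (a * b) = τ (b * a))
    (hτs : ∀ a : 𝔸, τ (star a) = starRingEnd ℂ (τ a)) {Cu Cl : ℝ} (hCu : ∀ a : 𝔸, fnorm τ a ≤ Cu * ‖a‖) (hCl : ∀ a : 𝔸, ‖a‖ ≤ Cl * fnorm τ a)
    (hCu0 : 0 ≤ Cu) (hCl0 : 0 ≤ Cl) (i : ZdIdx d L) {ac : Site d} {Mc ρc : ℕ} (hΩ : i.Ω = cubeFam false L ac Mc ρc i.k)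
    (hρc : L ≤ ρc) {m : ℕ} (hm : m ≤ i.k) (hηm : i.η * (L : ℝ) ^ m ≤ 1) (hkη : ((L : ℝ) ^ i.k)⁻¹ ≤ i.η)
    {a : ℕ → ℝ} (ha : ∀ j, 0 ≤ a j) {a_lo a_hi : ℝ} (halo : 0 < a_lo)
    (hlo : ∀ j ∈ Finset.range (m + 1), a_lo * ((L : ℝ) ^ d) ^ j * ((i.η * (L : ℝ) ^ j) ^ 2)⁻¹ ≤ a j)
    (hhi : ∀ j ∈ Finset.range (m + 1), a j ≤ a_hi * ((L : ℝ) ^ d) ^ j * ((i.η * (L : ℝ) ^ j) ^ 2)⁻¹)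
    {U₀ : Site d → Fin d → 𝔸ˣ} (hU : ∀ (x : Site d) (κ' : Fin d), U₀ x κ' ∈ unitaryUnits 𝔸)
    {α₀ : ℝ} (hα : 0 < α₀) (hα3 : C0 d * α₀ ≤ 1 / 3) (hα2 : 2 * α₀ ≤ c2' d L) (h52 : pdev U₀ < α₀ * (((L : ℝ) ^ i.k)⁻¹) ^ 2)
    {θ' : ℝ} (hθ' : 0 ≤ θ') (hR : ∀ (x : Site d) (μ : Fin d), ‖((U₀ x μ : 𝔸ˣ) : 𝔸) - 1‖ ≤ θ' * i.η)
    (hsmall : 4 * ((2 * Cu * Cl) ^ 2 * (d * θ' ^ 2 + a_hi * d ^ 2 * (L : ℝ) ^ 2 * (256 * (d + 1) * (d + 4) * α₀ + θ') ^ 2)) ≤ min 8 a_lo)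
    {κ : ℝ} (hκ0 : 0 ≤ κ) (hκ1 : κ ≤ 1) (hκ : κ * (48 * d + 120 * a_hi) ≤ min 8 a_lo)
    (z : Site d) (ν : Fin d) (X : 𝔸) (hz : z + e ν ∈ (cubeMember_Ω0_finite i hΩ).toFinset)
    {x : Site d} (hx : x ∈ (cubeMember_Ω0_finite i hΩ).toFinset) :
    fnorm τ ((GpZd L U₀ i.η τ hτp m a (fun j => (cubeLamS_finite L ac Mc ρc i.k m j).toFinset)
        (cubeMember_Ω0_finite i hΩ).toFinset hd i.hη.ne' hτt hτs hU ha
        (restrictSite (cubeMember_Ω0_finite i hΩ).toFinset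
          (covDivB i.η U₀ (fun y μ => if y = z ∧ μ = ν then X else 0))) : Site d → 𝔸) x) ≤
      24 / Real.sqrt (min 8 a_lo) * (i.η * (L : ℝ) ^ m) * Real.exp (-(κ * (((L : ℝ) ^ m)⁻¹ * ((linfDist z x : ℕ) : ℝ)))) * fnorm τ X := by
  classical
  have hTA : ∀ (y : Site d) (μ : Fin d), (fun y μ => if y = z ∧ μ = ν then X else (0 : 𝔸)) y μ ≠ 0 → y ∈ ({z} : Finset (Site d)) := by
    intro y μ h
    by_cases hy : y = z ∧ μ = ν
    · exact Finset.mem_singleton.2 hy.1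
    · exact absurd (by simp only [hy, if_false]) h
  have hhead : ∀ (y : Site d) (μ : Fin d), (fun y μ => if y = z ∧ μ = ν then X else (0 : 𝔸)) y μ ≠ 0 →
      y + e μ ∈ (cubeMember_Ω0_finite i hΩ).toFinset := by
    intro y μ h
    by_cases hy : y = z ∧ μ = ν
    · rw [hy.1, hy.2]; exact hz
    · exact absurd (by simp only [hy, if_false]) h
  have h := fnorm_GpZd_restrict_covDivB_le_exp_cubeMember_of_class L τ hτp hd hL hτt hτs hCu hCl hCu0 hCl0 i hΩ hρc hm hηm hkη ha halo hlo hhi hU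
    hα hα3 hα2 h52 hθ' hR hsmall hκ0 hκ1 hκ hTA hhead hx
  refine h.trans (le_of_eq ?_)
  simp only [Finset.sum_singleton, true_and]
  rw [Finset.sum_eq_single_of_mem ν (Finset.mem_univ ν) (fun μ _ hμ => by rw [if_neg hμ, fnorm_zero, mul_zero]), if_pos rfl]
  ring

end Literature.MathematicalPhysics.QuantumFieldTheory.Balaban1983to89.B9Thm31GpAgmonGradDivDecayClassZd

end
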